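import Mathlib.Geometry.Manifold.Complex
import Mathlib.Geometry.Manifold.BumpFunction
import Mathlib.Analysis.Calculus.FDeriv.RestrictScalars
import Literature.Analysis.Complex.DbarBumpResidue
import Literature.Analysis.Complex.PQPullback
import Literature.Geometry.Kaehler.CurveHolomorphicOneForms
import Literature.Geometry.Kaehler.KaehlerProofs
import Literature.Geometry.Kaehler.ChartRep
import Literature.Geometry.Kaehler.CousinChartConvex
import Literature.NumberTheory.Transcendental.FormIntegrationStokes
import Literature.NumberTheory.Transcendental.FormIntegrationPositivity
import Literature.NumberTheory.Transcendental.KaehlerHodgeOfRealProofs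
import HarnessLib

/-!
# The residue theorem for one pole on a compact complex curve

Family `hodge` / trunk Kähler, layer `Literature/Geometry/Kaehler`. Let `M` be a compact complex
manifold of complex dimension one (charts in the complex line `E`, `dim_ℂ E = 1`, holomorphic
transition maps), `p ∈ M`, `h : M → ℂ` holomorphic on `M ∖ {p}` and meromorphic at `p` (in the
chart at `p`), and `ω₁` a smooth closed `1`-form of type `(1,0)` on `M` (a holomorphic `1`-form).
Then **the residue at `p` of the meromorphic `1`-form `h ω₁` vanishes**
(`residueAt_eq_zero_of_mdifferentiableAt`): in the chart at `p`, identified with an open subset of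
`ℂ` by a `ℂ`-linear coordinate `ℓ : E ≃ ℂ`, `ω₁ = A(z) dz` with `A` holomorphic and
`Res_{z(p)} (h ∘ z⁻¹) · A = 0`.

This is the case of ONE pole of the residue theorem on a compact Riemann surface (Forster,
*Lectures on Riemann Surfaces*, Thm. 10.21; Miranda, *Algebraic Curves and Riemann Surfaces*,
Thm. IV.3.17; Donaldson, *Riemann Surfaces*, Prop. 6 of Ch. 6), in the `∂̄`-form of its standard
proof: with a cut-off `χ = 1` near `p` supported in the chart, the smooth global `1`-form
`β = (1 - χ) h ω₁` has `dβ = -h dχ ∧ ω₁` (because `d(h ω₁) = dh ∧ ω₁ = 0` off `p`: two `ℂ`-linear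
covectors on a complex LINE have vanishing wedge), Stokes gives `∫_M dβ = 0`, and in the chart
`-(dχ ∧ A dz)(∂ₓ, ∂_y) = -2i A ∂̄χ`, so that `0 = ∫_M dβ = 2i ∫_ℂ ∂̄χ · (h A) dA = -2πi Res (h A)`
by the tree's `Literature.Analysis.Complex.integral_dbarAlong_mul_eq_neg_pi_mul_residueAt`
(Hörmander, Thm. 1.2.1).

All inputs are PROVED in the tree: Stokes `MForm.integral_eq_zero_of_mem_exactSmoothForms_holds`
and the single-chart evaluation `MForm.integral_ofChart_smul` / `exists_ofChart_eq_smul`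
(`NumberTheory/Transcendental/FormIntegration*`), the orientation of complex manifolds
(`isContinuousOrientation_const`, `chartSign_const_eq`), the chart calculus of forms
(`Geometry/Kaehler/ManifoldFormsChart`: `inChart_mextDeriv_of_mem_target`, `SmoothAt`),
`ℂ`-linearity of holomorphic coordinate changes (`tangentCoordChange_eq_restrictScalars`), the
type-`(1,0)` rule `ω₁(iv) = i ω₁(v)` (`IsOfType.apply_I_smul`), and `Re d = d Re` on smooth forms
(`MForm.re_mextDeriv_holds`). Everything here is proved; no definitions, no named facts.

## Main statements

* `wedge_eval_eq_dbarAlong` — `L(w₁) w₂ - L(w₂) w₁ = 2iΔ · ½(L1 + iL(i))` for a real-linear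
  `L : ℂ → ℂ` (`Δ = Im(w̄₁ w₂)`): the pointwise identity `(dχ ∧ dz)(u, v) = 2iΔ ∂̄χ`;
* `differentiableAt_complex_of_dbarAlong_eq_zero` — a real-differentiable `A : ℂ → ℂ` with
  `∂̄A(z) = 0` is complex-differentiable at `z`;
* `exists_integral_comp_eq_mul` — transport of Haar integrals along `ℓ : E ≃L[ℝ] ℂ`;
* `inChart_apply_I_smul`, `inChart_apply_eq_mul` — in a holomorphic chart a `(1,0)`-form reads
  `A(z) dz`; `extDeriv_inChart_eq_zero` — a smooth closed form has closed chart representative;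
  `differentiableOn_coeff` — **`A` is holomorphic** for `ω₁` closed of type `(1,0)`;
* `mextDeriv_smul_eq_zero` — **`d(h ω₁) = 0`** near a point where `h` is holomorphic;
* `residueAt_eq_zero_of_mdifferentiableAt` — **the theorem.**

## References

* O. Forster, *Lectures on Riemann Surfaces*, GTM 81 (1981), §9–§10 (Thm. 10.21, the residue
  theorem, proved by Stokes with a cut-off).
* S. Donaldson, *Riemann Surfaces*, OUP (2011), Ch. 5–6 (held text `book:donaldson2011-riemann-surfaces`).
* L. Hörmander, *An Introduction to Complex Analysis in Several Variables* (1973), Thm. 1.2.1.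
  [HormanderSCV1973]
* C. Voisin, *Hodge Theory and Complex Algebraic Geometry I* (2002), §2.2.1, §2.3.1. [VoisinHodgeI2002]
-/

noncomputable section

open scoped Manifold ContDiff Topology
open Set Filter Function Complex MeasureTheory Module
open Literature.NumberTheory.Transcendental Literature.Analysis.Complex

-- The identification `TangentSpace I x = E` is an abuse of definitional equality; as in the tree's
-- tangent-bundle files we let `isDefEq` unfold it.
set_option backward.isDefEq.respectTransparency false

namespace Literature.Geometry.Kaehler

/-! ### Linear algebra on `ℂ` seen as a real plane -/

section PlaneAlgebra

/-- A real-linear map out of `ℂ` is determined by its values at `1` and `i`: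
`L(w) = Re w · L(1) + Im w · L(i)`. [folklore] -/
theorem realLinear_apply_eq {F : Type*} [AddCommGroup F] [Module ℝ F] (L : ℂ →ₗ[ℝ] F) (w : ℂ) :
    L w = w.re • L 1 + w.im • L I := by
  conv_lhs => rw [← Complex.re_add_im w]
  rw [map_add]
  have h1 : L (w.re : ℂ) = w.re • L 1 := by
    rw [← map_smul, Complex.real_smul, mul_one]
  have h2 : L ((w.im : ℂ) * I) = w.im • L I := by
    rw [← map_smul, Complex.real_smul]
  rw [h1, h2]

/-- **`(dχ ∧ dz)(u, v) = 2iΔ ∂̄χ`, pointwise.** For a real-linear `L : ℂ → ℂ` (the real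
differential of a function `χ`) and `w₁, w₂ ∈ ℂ`,
`L(w₁) w₂ - L(w₂) w₁ = 2i · Δ · ½(L(1) + i L(i))` with `Δ = Re w₁ Im w₂ - Re w₂ Im w₁`
(the oriented area of `(w₁, w₂)`); `½(L1 + iL(i))` is `∂̄χ`. [folklore] -/
theorem wedge_eval_eq (L : ℂ →L[ℝ] ℂ) (w₁ w₂ : ℂ) :
    L w₁ * w₂ - L w₂ * w₁ =
      2 * I * ((w₁.re * w₂.im - w₂.re * w₁.im : ℝ) : ℂ) * ((2 : ℂ)⁻¹ * (L 1 + I * L I)) := by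
  have h1 := realLinear_apply_eq L.toLinearMap w₁
  have h2 := realLinear_apply_eq L.toLinearMap w₂
  simp only [ContinuousLinearMap.coe_coe, Complex.real_smul] at h1 h2
  have e₁ := Complex.re_add_im w₁
  have e₂ := Complex.re_add_im w₂
  rw [h1, h2]
  push_cast
  linear_combination ((w₂.re : ℂ) * L 1 + (w₂.im : ℂ) * L I) * e₁
    - ((w₁.re : ℂ) * L 1 + (w₁.im : ℂ) * L I) * e₂
    + (-((w₁.re : ℂ) * (w₂.im : ℂ) - (w₂.re : ℂ) * (w₁.im : ℂ)) * L I) * Complex.I_sq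

/-- The same identity with the tree's `∂̄ = dbarAlong 1` of a function `χ : ℂ → ℂ` at `z`
(`L = Dχ(z)`): `Dχ(z)(w₁) w₂ - Dχ(z)(w₂) w₁ = 2iΔ ∂̄χ(z)`. [folklore] -/
theorem wedge_eval_eq_dbarAlong (χ : ℂ → ℂ) (z w₁ w₂ : ℂ) :
    fderiv ℝ χ z w₁ * w₂ - fderiv ℝ χ z w₂ * w₁ =
      2 * I * ((w₁.re * w₂.im - w₂.re * w₁.im : ℝ) : ℂ) * dbarAlong 1 χ z := by
  rw [wedge_eval_eq, dbarAlong_one]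
  simp [smul_eq_mul]

/-- **A real-differentiable function with `∂̄A(z) = 0` is complex-differentiable at `z`**: its real
differential `L` satisfies `L(i) = i L(1)`, hence is the `ℂ`-linear map `w ↦ L(1) w`.
[folklore] -/
theorem differentiableAt_complex_of_dbarAlong_eq_zero {A : ℂ → ℂ} {z : ℂ}
    (hA : DifferentiableAt ℝ A z) (h : dbarAlong 1 A z = 0) : DifferentiableAt ℂ A z := by
  set L := fderiv ℝ A z with hL
  have hI : L I = I * L 1 := by
    rw [dbarAlong_one, smul_eq_mul, mul_eq_zero] at h
    rcases h with h | h
    · norm_num at h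
    · have : L I = -I⁻¹ * L 1 := by
        field_simp
        linear_combination h
      rw [this, Complex.inv_I]
      ring
  refine (differentiableAt_iff_restrictScalars ℝ hA).2 ⟨L 1 • ContinuousLinearMap.id ℂ ℂ, ?_⟩
  ext w
  simp only [ContinuousLinearMap.coe_restrictScalars', _root_.smul_apply,
    ContinuousLinearMap.coe_id', id_eq, smul_eq_mul]
  have hw := realLinear_apply_eq L.toLinearMap w
  simp only [ContinuousLinearMap.coe_coe, Complex.real_smul] at hw
  rw [← hL, hw, hI]
  linear_combination (L 1) * (Complex.re_add_im w).symm

variable {E : Type*} [NormedAddCommGroup E] [NormedSpace ℂ E]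

/-- Two `ℂ`-homogeneous functionals on a complex line commute: `f(a) g(b) = f(b) g(a)`
(`dim_ℂ E = 1`; the vanishing of `(2,0)`-covectors on a curve). [folklore] -/
theorem apply_mul_apply_comm_of_line (h1 : finrank ℂ E = 1) {f g : E → ℂ}
    (hf : ∀ (c : ℂ) (v : E), f (c • v) = c * f v) (hg : ∀ (c : ℂ) (v : E), g (c • v) = c * g v)
    (a b : E) : f a * g b = f b * g a := by
  by_cases ha : a = 0
  · have hf0 : f 0 = 0 := by simpa using hf 0 0
    have hg0 : g 0 = 0 := by simpa using hg 0 0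
    rw [ha, hf0, hg0, zero_mul, mul_zero]
  · obtain ⟨c, rfl⟩ := (finrank_eq_one_iff_of_nonzero' a ha).1 h1 b
    rw [hf, hg]
    ring

/-- On a complex line with a `ℂ`-linear coordinate `ℓ : E ≃ ℂ`, every vector is `ℓ(v) · ℓ⁻¹(1)`.
[folklore] -/
theorem eq_smul_symm_one (ℓ : E ≃L[ℂ] ℂ) (v : E) : v = (ℓ v) • ℓ.symm 1 := by
  apply ℓ.injective
  rw [map_smul, ℓ.apply_symm_apply, smul_eq_mul, mul_one]

/-- A `ℂ`-homogeneous functional on the line `E` reads `f(v) = f(ℓ⁻¹ 1) · ℓ(v)` in the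
coordinate `ℓ`. [folklore] -/
theorem apply_eq_mul_coord (ℓ : E ≃L[ℂ] ℂ) {f : E → ℂ} (hf : ∀ (c : ℂ) (v : E), f (c • v) = c * f v)
    (v : E) : f v = f (ℓ.symm 1) * ℓ v := by
  conv_lhs => rw [eq_smul_symm_one ℓ v]
  rw [hf, mul_comm]

end PlaneAlgebra

/-! ### Transport of Haar integrals along a linear coordinate -/

section Haar

variable {E : Type*} [NormedAddCommGroup E] [NormedSpace ℝ E] [MeasurableSpace E] [BorelSpace E]

/-- **Change of variables along a linear isomorphism `ℓ : E ≃ ℂ`**: for an additive Haar measure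
`μ` on `E` there is a constant `c > 0` with `∫ G(ℓ y) dμ(y) = c ∫_ℂ G dA` for every `G` (the
push-forward `ℓ_* μ` is a Haar measure on `ℂ`, hence `c ·` Lebesgue). [folklore] -/
theorem exists_integral_comp_eq_mul (μ : Measure E) [μ.IsAddHaarMeasure] (ℓ : E ≃L[ℝ] ℂ) :
    ∃ c : ℝ, 0 < c ∧ ∀ G : ℂ → ℂ, ∫ y, G (ℓ y) ∂μ = (c : ℂ) * ∫ z, G z := by
  set ν : Measure ℂ := μ.map ℓ with hν
  haveI : ν.IsAddHaarMeasure := ℓ.isAddHaarMeasure_map μ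
  set c : NNReal := Measure.addHaarScalarFactor ν volume with hc
  have hνeq : ν = c • (volume : Measure ℂ) := Measure.isAddLeftInvariant_eq_smul ν volume
  have hcpos : 0 < c := Measure.addHaarScalarFactor_pos_of_isAddHaarMeasure ν volume
  refine ⟨c, NNReal.coe_pos.2 hcpos, fun G ↦ ?_⟩
  have h1 : ∫ y, G (ℓ y) ∂μ = ∫ z, G z ∂ν := by
    rw [hν]
    exact (integral_map_equiv ℓ.toHomeomorph.toMeasurableEquiv G).symm
  rw [h1, hνeq, integral_smul_nnreal_measure]
  rw [NNReal.smul_def, Complex.real_smul]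

end Haar


/-! ### Holomorphic charts: functions and `(1,0)`-forms read in a chart -/

section Chart

variable {E : Type*} [NormedAddCommGroup E] [NormedSpace ℂ E]
  {M : Type*} [TopologicalSpace M] [ChartedSpace E M]

omit [NormedAddCommGroup E] [NormedSpace ℂ E] in
/-- A vector `![v] : Fin 1 → E` pushed through a map. [folklore] -/
theorem comp_vecOne {F : Type*} (T : E → F) (v : E) : T ∘ ![v] = ![T v] := by
  funext i
  fin_cases i
  rfl

variable [IsManifold 𝓘(ℂ, E) ω M]

/-- **A holomorphic function read in a holomorphic chart is complex-differentiable**: if `h` is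
`ℂ`-differentiable (as a map of complex manifolds) at a point `x` of the source of the chart at
`x₀`, then `h ∘ (chart at x₀)⁻¹` is complex-differentiable at the image of `x`.
[cite: VoisinHodgeI2002, §2.2.1] -/
theorem differentiableAt_comp_extChartAt_symm {h : M → ℂ} {x₀ x : M}
    (hx : x ∈ (extChartAt 𝓘(ℝ, E) x₀).source) (hh : MDifferentiableAt 𝓘(ℂ, E) 𝓘(ℂ, ℂ) h x) :
    DifferentiableAt ℂ (h ∘ (extChartAt 𝓘(ℝ, E) x₀).symm) (extChartAt 𝓘(ℝ, E) x₀ x) := by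
  rw [extChartAt_real_eq_complex]
  have hx' : x ∈ (chartAt E x₀).source := by rwa [extChartAt_source] at hx
  have h2 := ((mdifferentiableAt_iff_of_mem_source (I := 𝓘(ℂ, E)) (I' := 𝓘(ℂ, ℂ)) hx'
    (y := h x) (by simp)).1 hh).2
  simp only [extChartAt_model_space_eq_id, PartialEquiv.refl_coe, Function.id_comp,
    ModelWithCorners.Boundaryless.range_eq_univ, differentiableWithinAt_univ] at h2
  exact h2

/-- **A holomorphic function read in a holomorphic chart is complex-differentiable on the image of
its domain of holomorphy**: if `h` is `ℂ`-differentiable at every point of the chart source other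
than `p`, then `h ∘ (chart at x₀)⁻¹` is complex-differentiable on `target ∖ {chart p}`.
[cite: VoisinHodgeI2002, §2.2.1] -/
theorem differentiableOn_comp_extChartAt_symm {h : M → ℂ} {x₀ p : M}
    (hh : ∀ x, x ≠ p → MDifferentiableAt 𝓘(ℂ, E) 𝓘(ℂ, ℂ) h x) :
    DifferentiableOn ℂ (h ∘ (extChartAt 𝓘(ℝ, E) x₀).symm)
      ((extChartAt 𝓘(ℝ, E) x₀).target \ {extChartAt 𝓘(ℝ, E) x₀ p}) := by
  intro y hy
  have hys : (extChartAt 𝓘(ℝ, E) x₀).symm y ∈ (extChartAt 𝓘(ℝ, E) x₀).source :=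
    (extChartAt 𝓘(ℝ, E) x₀).map_target hy.1
  have hne : (extChartAt 𝓘(ℝ, E) x₀).symm y ≠ p := by
    intro h0
    apply hy.2
    rw [mem_singleton_iff, ← h0, (extChartAt 𝓘(ℝ, E) x₀).right_inv hy.1]
  have h := differentiableAt_comp_extChartAt_symm hys (hh _ hne)
  rw [(extChartAt 𝓘(ℝ, E) x₀).right_inv hy.1] at h
  exact h.differentiableWithinAt

variable [IsManifold 𝓘(ℝ, E) ∞ M]

/-- **In a holomorphic chart a `(1,0)`-form has `ℂ`-linear values**: the chart representative
`Ω = ω₁.inChart x₀` of a form of type `(1,0)` satisfies `Ω(y)(iv) = i Ω(y)(v)` on the chart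
target (`Ω(y) = ω₁(z) ∘ T` with `T` the tangent coordinate change, which is `ℂ`-linear on a
complex manifold, `tangentCoordChange_eq_restrictScalars`, and `ω₁(z)(iw) = i ω₁(z)(w)`,
`IsOfType.apply_I_smul`). [cite: VoisinHodgeI2002, §2.2.1 and §2.3.1] -/
theorem inChart_apply_I_smul {ω₁ : MForm 𝓘(ℝ, E) M ℂ 1} (hωt : IsOfType 1 0 ω₁) {x₀ : M} {y : E}
    (hy : y ∈ (extChartAt 𝓘(ℝ, E) x₀).target) (v : E) :
    ω₁.inChart x₀ y ![I • v] = I * ω₁.inChart x₀ y ![v] := by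
  set z := (extChartAt 𝓘(ℝ, E) x₀).symm y with hz
  have hzs : z ∈ (extChartAt 𝓘(ℂ, E) x₀).source ∩ (extChartAt 𝓘(ℂ, E) z).source :=
    ⟨(extChartAt 𝓘(ℝ, E) x₀).map_target hy, mem_extChartAt_source z⟩
  have key : ∀ w : E, tangentCoordChange 𝓘(ℝ, E) x₀ z z (I • w) =
      I • tangentCoordChange 𝓘(ℝ, E) x₀ z z w := fun w ↦ by
    rw [tangentCoordChange_eq_restrictScalars hzs, ContinuousLinearMap.coe_restrictScalars', map_smul]
  rw [MForm.inChart_eq_of_mem_target ω₁ hy]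
  simp only [ContinuousAlternatingMap.compContinuousLinearMap_apply, ← hz]
  rw [comp_vecOne, comp_vecOne]
  have h := hωt.apply_I_smul z (tangentCoordChange 𝓘(ℝ, E) x₀ z z v)
  convert h using 3
  · exact key v
  · rfl

/-- `ℂ`-homogeneity of the chart representative of a `(1,0)`-form: `Ω(y)(cv) = c Ω(y)(v)`.
[cite: VoisinHodgeI2002, §2.3.1] -/
theorem inChart_apply_smul {ω₁ : MForm 𝓘(ℝ, E) M ℂ 1} (hωt : IsOfType 1 0 ω₁) {x₀ : M} {y : E}
    (hy : y ∈ (extChartAt 𝓘(ℝ, E) x₀).target) (c : ℂ) (v : E) :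
    ω₁.inChart x₀ y ![c • v] = c * ω₁.inChart x₀ y ![v] :=
  oneForm_apply_smul_of_apply_I_smul _ (inChart_apply_I_smul hωt hy) c v

/-- **`ω₁ = A dz` in a chart**: with a `ℂ`-linear coordinate `ℓ : E ≃ ℂ`, the chart
representative of a `(1,0)`-form is `Ω(y)(v) = A(y) ℓ(v)` with `A(y) = Ω(y)(ℓ⁻¹ 1)`.
[cite: VoisinHodgeI2002, §2.3.1] -/
theorem inChart_apply_eq_mul {ω₁ : MForm 𝓘(ℝ, E) M ℂ 1} (hωt : IsOfType 1 0 ω₁) (ℓ : E ≃L[ℂ] ℂ)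
    {x₀ : M} {y : E} (hy : y ∈ (extChartAt 𝓘(ℝ, E) x₀).target) (v : E) :
    ω₁.inChart x₀ y ![v] = ω₁.inChart x₀ y ![ℓ.symm 1] * ℓ v :=
  apply_eq_mul_coord ℓ (f := fun v ↦ ω₁.inChart x₀ y ![v]) (fun c v ↦ inChart_apply_smul hωt hy c v) v

omit [IsManifold 𝓘(ℂ, E) ω M] in
/-- **A smooth closed form has closed chart representatives**: `d(ω₁.inChart x₀) = 0` on the
chart target (chart formula for `d`, `inChart_mextDeriv_of_mem_target`). [folklore] -/
theorem extDeriv_inChart_eq_zero {k : ℕ} {ω₁ : MForm 𝓘(ℝ, E) M ℂ k} (hωs : IsSmoothForm ω₁)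
    (hωc : IsClosedForm ω₁) {x₀ : M} {y : E} (hy : y ∈ (extChartAt 𝓘(ℝ, E) x₀).target) :
    extDeriv (ω₁.inChart x₀) y = 0 := by
  have h := inChart_mextDeriv_of_mem_target ω₁ hy (hωs _)
  have h0 : mextDeriv ω₁ = 0 := hωc
  rw [h0, MForm.inChart_zero, ModelWithCorners.Boundaryless.range_eq_univ, extDerivWithin_univ] at h
  exact h.symm

/-- Differentiating the evaluation of a form-valued map: `D(y ↦ Ω(y)(w))(u) = DΩ(y)(u)(w)`.
[folklore] -/
theorem fderiv_apply_vecOne {F : Type*} [NormedAddCommGroup F] [NormedSpace ℝ F]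
    {Ω : E → E [⋀^Fin 1]→L[ℝ] F} {y : E} (hΩ : DifferentiableAt ℝ Ω y) (w u : E) :
    fderiv ℝ (fun y ↦ Ω y ![w]) y u = fderiv ℝ Ω y u ![w] := by
  have h := ((ContinuousAlternatingMap.apply ℝ E F ![w]).hasFDerivAt.comp y hΩ.hasFDerivAt).fderiv
  rw [show (fun y ↦ Ω y ![w]) = (ContinuousAlternatingMap.apply ℝ E F ![w]) ∘ Ω from rfl, h]
  rfl

/-- The exterior derivative of a `1`-form on two vectors:
`dΩ(y)(u, v) = DΩ(y)(u)(v) - DΩ(y)(v)(u)`. [folklore] -/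
theorem extDeriv_apply_vecTwo {F : Type*} [NormedAddCommGroup F] [NormedSpace ℝ F]
    {Ω : E → E [⋀^Fin 1]→L[ℝ] F} {y : E} (hΩ : DifferentiableAt ℝ Ω y) (u v : E) :
    extDeriv Ω y ![u, v] = fderiv ℝ Ω y u ![v] - fderiv ℝ Ω y v ![u] := by
  rw [extDeriv_apply hΩ, Fin.sum_univ_two]
  have h0 : Fin.removeNth (0 : Fin 2) ![u, v] = ![v] := by
    funext i; fin_cases i; rfl
  have h1 : Fin.removeNth (1 : Fin 2) ![u, v] = ![u] := by
    funext i; fin_cases i; rfl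
  simp only [Fin.val_zero, pow_zero, one_smul, Matrix.cons_val_zero, h0, Fin.val_one, pow_one,
    neg_smul, Matrix.cons_val_one, Matrix.cons_val_fin_one, h1, fderiv_apply_vecOne hΩ]
  abel

/-- **The coefficient `A` of a closed `(1,0)`-form is holomorphic.** For `ω₁` smooth, closed, of
type `(1,0)` and a `ℂ`-linear coordinate `ℓ : E ≃ ℂ` (`dim_ℂ E = 1`), the function
`A(z) = Ω(ℓ⁻¹ z)(ℓ⁻¹ 1)` (`Ω = ω₁.inChart x₀`, so `Ω = A dz`) is complex-differentiable on the
image of the chart target: `0 = dΩ(ℓ⁻¹1, ℓ⁻¹i) = ∂A/∂z̄ · 2i`. (A closed `(1,0)`-form on a curve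
is holomorphic: `dα = ∂̄α` for `α ∈ A^{1,0}`.) [cite: VoisinHodgeI2002, §2.3.1–2.3.3] -/
theorem differentiableOn_coeff {ω₁ : MForm 𝓘(ℝ, E) M ℂ 1} (hωs : IsSmoothForm ω₁)
    (hωc : IsClosedForm ω₁) (hωt : IsOfType 1 0 ω₁) (ℓ : E ≃L[ℂ] ℂ) (x₀ : M) :
    DifferentiableOn ℂ (fun z : ℂ ↦ ω₁.inChart x₀ (ℓ.symm z) ![ℓ.symm 1])
      (ℓ.symm ⁻¹' (extChartAt 𝓘(ℝ, E) x₀).target) := by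
  set T := (extChartAt 𝓘(ℝ, E) x₀).target with hT
  set Ω := ω₁.inChart x₀ with hΩ
  set A : ℂ → ℂ := fun z ↦ Ω (ℓ.symm z) ![ℓ.symm 1] with hA
  have hTo : IsOpen (ℓ.symm ⁻¹' T) := (isOpen_extChartAt_target x₀).preimage ℓ.symm.continuous
  have hΩs : ContDiffOn ℝ ∞ Ω T := hωs.contDiffOn_inChart_complex x₀
  -- `A` is real-`C^∞` on the open set
  have hAs : ContDiffOn ℝ ∞ A (ℓ.symm ⁻¹' T) := by
    have h1 : ContDiffOn ℝ ∞ (Ω ∘ ℓ.symm) (ℓ.symm ⁻¹' T) :=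
      hΩs.comp (ℓ.symm.contDiff.restrict_scalars ℝ).contDiffOn fun z hz ↦ hz
    exact ((ContinuousAlternatingMap.apply ℝ E ℂ ![ℓ.symm 1]).contDiff.of_le le_top).comp_contDiffOn h1
  intro z hz
  have hzn : ℓ.symm ⁻¹' T ∈ 𝓝 z := hTo.mem_nhds hz
  have hAd : DifferentiableAt ℝ A z := (hAs.differentiableOn (by simp)).differentiableAt hzn
  refine (differentiableAt_complex_of_dbarAlong_eq_zero hAd ?_).differentiableWithinAt
  -- `∂̄A(z) = 0` from `dΩ = 0` evaluated on `(ℓ⁻¹ 1, ℓ⁻¹ i)`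
  set y := ℓ.symm z with hy
  have hyT : y ∈ T := hz
  have hΩd : DifferentiableAt ℝ Ω y :=
    (hΩs.differentiableOn (by simp)).differentiableAt ((isOpen_extChartAt_target x₀).mem_nhds hyT)
  have hd0 := extDeriv_inChart_eq_zero hωs hωc (x₀ := x₀) hyT
  rw [← hΩ] at hd0
  have hev := extDeriv_apply_vecTwo hΩd (ℓ.symm 1) (ℓ.symm I)
  rw [hd0, ContinuousAlternatingMap.coe_zero, Pi.zero_apply] at hev
  -- `D(y ↦ Ω y (w))(u) = DA(z)(ℓ u) ℓ w`
  have hAℓ : ∀ w : E, ∀ y' ∈ T, Ω y' ![w] = A (ℓ y') * ℓ w := fun w y' hy' ↦ by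
    rw [hA]
    dsimp only
    rw [ℓ.symm_apply_apply]
    exact inChart_apply_eq_mul hωt ℓ hy' w
  have hDer : ∀ w u : E, fderiv ℝ Ω y u ![w] = fderiv ℝ A z (ℓ u) * ℓ w := by
    intro w u
    rw [← fderiv_apply_vecOne hΩd]
    have hloc : (fun y' ↦ Ω y' ![w]) =ᶠ[𝓝 y] fun y' ↦ A (ℓ y') * ℓ w := by
      filter_upwards [(isOpen_extChartAt_target x₀).mem_nhds hyT] with y' hy'
      exact hAℓ w y' hy'
    rw [hloc.fderiv_eq]
    have hℓy : ℓ y = z := by simp [hy]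
    have hAy : DifferentiableAt ℝ A (ℓ y) := by rw [hℓy]; exact hAd
    have hℓf : HasFDerivAt (fun y' : E ↦ ℓ y') (ℓ.toContinuousLinearMap.restrictScalars ℝ) y :=
      (ℓ.toContinuousLinearMap.restrictScalars ℝ).hasFDerivAt
    have hAℓd : DifferentiableAt ℝ (fun y' : E ↦ A (ℓ y')) y := hAy.comp y hℓf.differentiableAt
    rw [fderiv_mul_const hAℓd]
    have hc : fderiv ℝ (fun y' : E ↦ A (ℓ y')) y u = fderiv ℝ A z (ℓ u) := by
      rw [show (fun y' : E ↦ A (ℓ y')) = A ∘ (fun y' : E ↦ ℓ y') from rfl,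
        (hAy.hasFDerivAt.comp y hℓf).fderiv]
      simp [hℓy]
    simp only [_root_.smul_apply, smul_eq_mul, hc]
    ring
  rw [hDer, hDer] at hev
  simp only [ContinuousLinearEquiv.apply_symm_apply, mul_one] at hev
  have hLI : fderiv ℝ A z I = I * fderiv ℝ A z 1 := by linear_combination hev
  rw [dbarAlong_one, smul_eq_mul]
  linear_combination ((2 : ℂ)⁻¹ * I) * hLI + ((2 : ℂ)⁻¹ * fderiv ℝ A z 1) * Complex.I_sq

end Chart


/-! ### Holomorphic functions times holomorphic forms: smoothness and closedness -/

section Product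

variable {E : Type*} [NormedAddCommGroup E] [NormedSpace ℂ E] [FiniteDimensional ℂ E]
  {M : Type*} [TopologicalSpace M] [ChartedSpace E M]
  [IsManifold 𝓘(ℂ, E) ω M] [IsManifold 𝓘(ℝ, E) ∞ M] {k : ℕ}

omit [FiniteDimensional ℂ E] [IsManifold 𝓘(ℂ, E) ω M] [IsManifold 𝓘(ℝ, E) ∞ M] in
/-- The chart representative is linear over functions: `(h ω₁).inChart x₀ = (h ∘ chart⁻¹) · ω₁.inChart x₀`.
[folklore] -/
theorem inChart_fun_smul (h : M → ℂ) (ω₁ : MForm 𝓘(ℝ, E) M ℂ k) (x₀ : M) :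
    MForm.inChart (fun x ↦ h x • ω₁ x : MForm 𝓘(ℝ, E) M ℂ k) x₀ =
      fun y ↦ h ((extChartAt 𝓘(ℝ, E) x₀).symm y) • ω₁.inChart x₀ y := by
  funext y
  ext v
  rfl

omit [IsManifold 𝓘(ℝ, E) ∞ M] in
/-- **Near a point of holomorphy, `h ∘ chart⁻¹` is real-`C^∞`**: if `h` is `ℂ`-differentiable at
every point near `x` (as a map of complex manifolds), then `h ∘ (chart at x)⁻¹` is `C^∞` over `ℝ`
at the centre of the chart (holomorphic ⇒ smooth). [cite: VoisinHodgeI2002, §2.2.1] -/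
theorem contDiffAt_comp_extChartAt_symm {h : M → ℂ} {x : M}
    (hh : ∀ᶠ x' in 𝓝 x, MDifferentiableAt 𝓘(ℂ, E) 𝓘(ℂ, ℂ) h x') :
    ContDiffAt ℝ ∞ (h ∘ (extChartAt 𝓘(ℝ, E) x).symm) (extChartAt 𝓘(ℝ, E) x x) := by
  set φ := extChartAt 𝓘(ℝ, E) x with hφ
  -- points of the target near the centre whose preimage is a point of holomorphy
  have hev : ∀ᶠ y in 𝓝 (φ x), y ∈ φ.target ∧ MDifferentiableAt 𝓘(ℂ, E) 𝓘(ℂ, ℂ) h (φ.symm y) := by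
    have h1 : ∀ᶠ y in 𝓝 (φ x), y ∈ φ.target :=
      (isOpen_extChartAt_target (I := 𝓘(ℝ, E)) x).mem_nhds (mem_extChartAt_target (I := 𝓘(ℝ, E)) x)
    have hc : ContinuousAt φ.symm (φ x) := continuousAt_extChartAt_symm x
    have hh' : ∀ᶠ x' in 𝓝 (φ.symm (φ x)), MDifferentiableAt 𝓘(ℂ, E) 𝓘(ℂ, ℂ) h x' := by
      rwa [extChartAt_to_inv]
    exact h1.and (hc.eventually hh')
  obtain ⟨W, hW, hWo, hxW⟩ := _root_.eventually_nhds_iff.1 hev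
  have hdiff : DifferentiableOn ℂ (h ∘ φ.symm) W := by
    intro y hy
    have hys : φ.symm y ∈ φ.source := φ.map_target (hW y hy).1
    have hd := differentiableAt_comp_extChartAt_symm hys (hW y hy).2
    rw [φ.right_inv (hW y hy).1] at hd
    exact hd.differentiableWithinAt
  exact (Literature.Analysis.Complex.contDiffOn_real_of_differentiableOn hdiff hWo).contDiffAt
    (hWo.mem_nhds hxW)

omit [IsManifold 𝓘(ℝ, E) ∞ M] in
/-- **A holomorphic function times a smooth form is smooth** near a point of holomorphy: if `h` is
`ℂ`-differentiable near `x` and `ω₁` is smooth at `x`, then `h ω₁` is smooth at `x`.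
[cite: VoisinHodgeI2002, §2.2.1] -/
theorem smoothAt_fun_smul {h : M → ℂ} {ω₁ : MForm 𝓘(ℝ, E) M ℂ k} {x : M}
    (hh : ∀ᶠ x' in 𝓝 x, MDifferentiableAt 𝓘(ℂ, E) 𝓘(ℂ, ℂ) h x') (hω : ω₁.SmoothAt x) :
    MForm.SmoothAt (fun x' ↦ h x' • ω₁ x' : MForm 𝓘(ℝ, E) M ℂ k) x := by
  unfold MForm.SmoothAt
  rw [inChart_fun_smul]
  exact (contDiffAt_comp_extChartAt_symm hh).contDiffWithinAt.smul hω

omit [FiniteDimensional ℂ E] in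
/-- The real differential of a complex-differentiable scalar function is `ℂ`-homogeneous.
[folklore] -/
theorem fderiv_real_apply_smul_of_differentiableAt {H : E → ℂ} {y : E}
    (hH : DifferentiableAt ℂ H y) (c : ℂ) (v : E) :
    fderiv ℝ H y (c • v) = c * fderiv ℝ H y v := by
  rw [(hH.hasFDerivAt.restrictScalars ℝ).fderiv]
  simp

omit [FiniteDimensional ℂ E] in
/-- **`d(h ω₁) = 0` for `h` holomorphic and `ω₁` a closed `(1,0)`-form on a curve.** On a complex
curve `M` (`dim_ℂ E = 1`), if `h` is `ℂ`-differentiable near `x` and `ω₁` is smooth, closed and of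
type `(1,0)`, then `d(h ω₁)(x) = 0`: in the chart at `x`, `d(H Ω) = H dΩ + dH ∧ Ω`, `dΩ = 0`, and
`dH ∧ Ω` vanishes because `dH(x)` and `Ω(x)` are `ℂ`-linear covectors on a complex line (a
`(2,0)`-form on a curve is zero). [cite: VoisinHodgeI2002, §2.3.1–2.3.3] -/
theorem mextDeriv_fun_smul_eq_zero (h1 : finrank ℂ E = 1) {h : M → ℂ} {ω₁ : MForm 𝓘(ℝ, E) M ℂ 1}
    {x : M} (hh : ∀ᶠ x' in 𝓝 x, MDifferentiableAt 𝓘(ℂ, E) 𝓘(ℂ, ℂ) h x') (hωs : IsSmoothForm ω₁)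
    (hωc : IsClosedForm ω₁) (hωt : IsOfType 1 0 ω₁) :
    mextDeriv (fun x' ↦ h x' • ω₁ x' : MForm 𝓘(ℝ, E) M ℂ 1) x = 0 := by
  set φ := extChartAt 𝓘(ℝ, E) x with hφ
  set y₀ := φ x with hy₀
  set Ω := ω₁.inChart x with hΩ
  set H : E → ℂ := h ∘ φ.symm with hH
  have hy₀t : y₀ ∈ φ.target := mem_extChartAt_target x
  -- differentiability of the factors at the centre
  have hHd : DifferentiableAt ℂ H y₀ := by
    have := differentiableAt_comp_extChartAt_symm (mem_extChartAt_source (I := 𝓘(ℝ, E)) x)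
      (hh.self_of_nhds)
    exact this
  have hHdr : DifferentiableAt ℝ H y₀ := hHd.restrictScalars ℝ
  have hΩd : DifferentiableAt ℝ Ω y₀ := by
    have hc : ContDiffWithinAt ℝ ∞ Ω (range 𝓘(ℝ, E)) y₀ := hωs x
    rw [ModelWithCorners.Boundaryless.range_eq_univ, contDiffWithinAt_univ] at hc
    exact hc.differentiableAt (by simp)
  rw [mextDeriv_eq_extDerivWithin, ModelWithCorners.Boundaryless.range_eq_univ, extDerivWithin_univ,
    inChart_fun_smul]
  change extDeriv (fun y ↦ H y • Ω y) y₀ = 0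
  have hprod : DifferentiableAt ℝ (fun y ↦ H y • Ω y) y₀ := hHdr.smul hΩd
  ext v
  have hv : v = ![v 0, v 1] := by
    funext i; fin_cases i <;> rfl
  rw [hv, extDeriv_apply_vecTwo hprod, fderiv_fun_smul hHdr hΩd]
  simp only [_root_.add_apply, _root_.smul_apply,
    ContinuousLinearMap.smulRight_apply, ContinuousAlternatingMap.add_apply,
    ContinuousAlternatingMap.smul_apply, smul_eq_mul, ContinuousAlternatingMap.coe_zero,
    Pi.zero_apply]
  -- `dΩ(y₀) = 0` and `dH ∧ Ω = 0`
  have hdΩ : fderiv ℝ Ω y₀ (v 0) ![v 1] - fderiv ℝ Ω y₀ (v 1) ![v 0] = 0 := by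
    rw [← extDeriv_apply_vecTwo hΩd, hΩ, extDeriv_inChart_eq_zero hωs hωc hy₀t,
      ContinuousAlternatingMap.coe_zero, Pi.zero_apply]
  have hcomm : fderiv ℝ H y₀ (v 0) * Ω y₀ ![v 1] = fderiv ℝ H y₀ (v 1) * Ω y₀ ![v 0] :=
    apply_mul_apply_comm_of_line h1 (f := fun w ↦ fderiv ℝ H y₀ w) (g := fun w ↦ Ω y₀ ![w])
      (fderiv_real_apply_smul_of_differentiableAt hHd) (fun c w ↦ inChart_apply_smul hωt hy₀t c w)
      (v 0) (v 1)
  linear_combination (H y₀) * hdΩ + hcomm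

end Product


/-! ### The cut-off form `β = (1 - χ) h ω₁` -/

section Cutoff

variable {E : Type*} [NormedAddCommGroup E] [NormedSpace ℂ E] [FiniteDimensional ℂ E]
  {M : Type*} [TopologicalSpace M] [ChartedSpace E M]
  [IsManifold 𝓘(ℂ, E) ω M] [IsManifold 𝓘(ℝ, E) ∞ M] [T2Space M] {p : M}

omit [IsManifold 𝓘(ℂ, E) ω M] [IsManifold 𝓘(ℝ, E) ∞ M] [T2Space M] in
/-- A smooth bump function centred at `p`, read on the target of the chart at `p`, is its
underlying flat bump. [folklore] -/
theorem bump_apply_symm (f : SmoothBumpFunction 𝓘(ℝ, E) p) {y : E}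
    (hy : y ∈ (extChartAt 𝓘(ℝ, E) p).target) :
    f ((extChartAt 𝓘(ℝ, E) p).symm y) = f.toContDiffBump y := by
  have hs : (extChartAt 𝓘(ℝ, E) p).symm y ∈ (chartAt E p).source := by
    rw [← extChartAt_source 𝓘(ℝ, E)]
    exact (extChartAt 𝓘(ℝ, E) p).map_target hy
  rw [f.eqOn_source hs, Function.comp_apply, (extChartAt 𝓘(ℝ, E) p).right_inv hy]

omit [IsManifold 𝓘(ℂ, E) ω M] [IsManifold 𝓘(ℝ, E) ∞ M] [T2Space M] [FiniteDimensional ℂ E] in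
/-- **Nested bump functions at a point**: there are smooth bump functions `f₁, f₂` centred at `p`
(in the chart at `p`) with `f₁.rOut < f₂.rIn`, so that `f₂ = 1` on a neighbourhood of
`tsupport f₁`. [folklore] -/
theorem exists_smoothBumpFunction_lt (p : M) :
    ∃ f₁ f₂ : SmoothBumpFunction 𝓘(ℝ, E) p, f₁.rOut < f₂.rIn := by
  obtain ⟨R, hR, hRT⟩ := Metric.mem_nhds_iff.1
    ((isOpen_extChartAt_target (I := 𝓘(ℝ, E)) p).mem_nhds (mem_extChartAt_target (I := 𝓘(ℝ, E)) p))
  have hcb : Metric.closedBall (extChartAt 𝓘(ℝ, E) p p) (R / 2) ∩ range 𝓘(ℝ, E) ⊆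
      (extChartAt 𝓘(ℝ, E) p).target := fun y hy ↦
    hRT (Metric.closedBall_subset_ball (by linarith) hy.1)
  have hcb' : Metric.closedBall (extChartAt 𝓘(ℝ, E) p p) (R / 8) ∩ range 𝓘(ℝ, E) ⊆
      (extChartAt 𝓘(ℝ, E) p).target := fun y hy ↦
    hRT (Metric.closedBall_subset_ball (by linarith) hy.1)
  exact ⟨⟨⟨R / 16, R / 8, by positivity, by linarith⟩, hcb'⟩,
    ⟨⟨R / 4, R / 2, by positivity, by linarith⟩, hcb⟩, by change R / 8 < R / 4; linarith⟩

omit [IsManifold 𝓘(ℂ, E) ω M] [IsManifold 𝓘(ℝ, E) ∞ M] [T2Space M] [FiniteDimensional ℂ E] in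
/-- The chart representative of the cut-off form `β = (1 - f₁) h ω₁` at `p`. [folklore] -/
theorem inChart_cutoff (f₁ : M → ℝ) (h : M → ℂ) (ω₁ : MForm 𝓘(ℝ, E) M ℂ 1) :
    MForm.inChart (fun x ↦ ((1 : ℂ) - f₁ x) • (h x • ω₁ x) : MForm 𝓘(ℝ, E) M ℂ 1) p =
      fun y ↦ (((1 : ℂ) - f₁ ((extChartAt 𝓘(ℝ, E) p).symm y)) * h ((extChartAt 𝓘(ℝ, E) p).symm y)) •
        ω₁.inChart p y := by
  funext y
  ext v
  simp only [MForm.inChart_apply, ContinuousAlternatingMap.smul_apply, smul_eq_mul, mul_assoc]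

variable (f₁ : SmoothBumpFunction 𝓘(ℝ, E) p) {h : M → ℂ} {ω₁ : MForm 𝓘(ℝ, E) M ℂ 1}

omit [IsManifold 𝓘(ℂ, E) ω M] [IsManifold 𝓘(ℝ, E) ∞ M] [T2Space M] in
/-- Off the support of the cut-off, `β = h ω₁`. [folklore] -/
theorem cutoff_eventuallyEq {x : M} (hx : x ∉ tsupport f₁) :
    ∀ᶠ w in 𝓝 x, (fun x ↦ ((1 : ℂ) - f₁ x) • (h x • ω₁ x) : MForm 𝓘(ℝ, E) M ℂ 1) w =
      (fun x' ↦ h x' • ω₁ x' : MForm 𝓘(ℝ, E) M ℂ 1) w := by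
  have h0 : (⇑f₁) =ᶠ[𝓝 x] 0 := notMem_tsupport_iff_eventuallyEq.1 hx
  filter_upwards [h0] with w hw
  simp [hw]

omit [IsManifold 𝓘(ℂ, E) ω M] [IsManifold 𝓘(ℝ, E) ∞ M] [T2Space M] in
/-- A point off the support of a bump centred at `p` is not `p`. [folklore] -/
theorem ne_of_notMem_tsupport {x : M} (hx : x ∉ tsupport f₁) : x ≠ p := by
  rintro rfl
  exact hx (subset_tsupport _ f₁.c_mem_support)

/-- **The cut-off form `β = (1 - f₁) h ω₁` is a smooth global `1`-form** when `h` is holomorphic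
off `p` and `ω₁` is smooth: near `p` it vanishes, on the rest of the chart at `p` it is a
product of smooth data, and off the support of `f₁` it is `h ω₁`. [folklore] -/
theorem isSmoothForm_cutoff (hh : ∀ x, x ≠ p → MDifferentiableAt 𝓘(ℂ, E) 𝓘(ℂ, ℂ) h x)
    (hωs : IsSmoothForm ω₁) :
    IsSmoothForm (fun x ↦ ((1 : ℂ) - f₁ x) • (h x • ω₁ x) : MForm 𝓘(ℝ, E) M ℂ 1) := by
  set φ := extChartAt 𝓘(ℝ, E) p with hφ
  set β : MForm 𝓘(ℝ, E) M ℂ 1 := fun x ↦ ((1 : ℂ) - f₁ x) • (h x • ω₁ x) with hβ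
  intro x
  change β.SmoothAt x
  by_cases hx : x ∈ tsupport f₁
  · -- in the chart at `p`
    have hxs : x ∈ φ.source := f₁.tsupport_subset_extChartAt_source hx
    refine MForm.smoothAt_of_contDiffWithinAt_inChart hxs ?_
    rw [ModelWithCorners.Boundaryless.range_eq_univ, contDiffWithinAt_univ, hβ, inChart_cutoff]
    have hxT : φ x ∈ φ.target := φ.map_source hxs
    have hΩc : ContDiffAt ℝ ∞ (ω₁.inChart p) (φ x) :=
      (hωs.contDiffOn_inChart_complex p).contDiffAt ((isOpen_extChartAt_target p).mem_nhds hxT)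
    by_cases hxp : x = p
    · -- near the centre the scalar factor vanishes identically
      have hF0 : (fun y ↦ ((1 : ℂ) - f₁ (φ.symm y)) * h (φ.symm y)) =ᶠ[𝓝 (φ x)] fun _ ↦ 0 := by
        have hball : ∀ᶠ y in 𝓝 (φ x), y ∈ φ.target ∧ dist y (φ p) < f₁.rIn := by
          have hA : ∀ᶠ y in 𝓝 (φ x), y ∈ φ.target := (isOpen_extChartAt_target p).mem_nhds hxT
          have hB : ∀ᶠ y in 𝓝 (φ x), dist y (φ p) < f₁.rIn := by
            rw [hxp]
            exact Metric.eventually_nhds_iff.2 ⟨f₁.rIn, f₁.rIn_pos, fun y hy ↦ hy⟩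
          filter_upwards [hA, hB] with y hy1 hy2 using ⟨hy1, hy2⟩
        filter_upwards [hball] with y hy
        have hys : φ.symm y ∈ (chartAt E p).source := by
          rw [← extChartAt_source 𝓘(ℝ, E)]; exact φ.map_target hy.1
        have h1 : f₁ (φ.symm y) = 1 :=
          f₁.one_of_dist_le hys (by rw [φ.right_inv hy.1]; exact hy.2.le)
        simp [h1]
      have h0 : (fun y ↦ (((1 : ℂ) - f₁ (φ.symm y)) * h (φ.symm y)) • ω₁.inChart p y) =ᶠ[𝓝 (φ x)]
          fun _ ↦ 0 := by
        filter_upwards [hF0] with y hy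
        rw [hy, zero_smul]
      exact contDiffAt_const.congr_of_eventuallyEq h0
    · -- away from the centre: product of smooth functions
      have hne : φ x ≠ φ p := fun he ↦ hxp (φ.injOn hxs (mem_extChartAt_source p) he)
      have hVo : IsOpen (φ.target \ {φ p}) := (isOpen_extChartAt_target p).sdiff isClosed_singleton
      have hxV : φ x ∈ φ.target \ {φ p} := ⟨hxT, hne⟩
      have hHc : ContDiffAt ℝ ∞ (h ∘ φ.symm) (φ x) :=
        (Literature.Analysis.Complex.contDiffOn_real_of_differentiableOn
          (differentiableOn_comp_extChartAt_symm hh) hVo).contDiffAt (hVo.mem_nhds hxV)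
      have hbc : ContDiffAt ℝ ∞ (fun y ↦ ((1 : ℂ) - (f₁.toContDiffBump y : ℂ))) (φ x) :=
        (contDiff_const.sub (Complex.ofRealCLM.contDiff.comp f₁.contDiff)).contDiffAt
      have hF : (fun y ↦ ((1 : ℂ) - f₁ (φ.symm y)) * h (φ.symm y)) =ᶠ[𝓝 (φ x)]
          fun y ↦ ((1 : ℂ) - (f₁.toContDiffBump y : ℂ)) * (h ∘ φ.symm) y := by
        filter_upwards [(isOpen_extChartAt_target p).mem_nhds hxT] with y hy
        rw [bump_apply_symm f₁ hy, Function.comp_apply]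
      have hFc : ContDiffAt ℝ ∞ (fun y ↦ ((1 : ℂ) - f₁ (φ.symm y)) * h (φ.symm y)) (φ x) :=
        (hbc.mul hHc).congr_of_eventuallyEq hF
      exact hFc.smul hΩc
  · -- off the support: `β = h ω₁`
    have hp : x ≠ p := ne_of_notMem_tsupport f₁ hx
    have hhx : ∀ᶠ x' in 𝓝 x, MDifferentiableAt 𝓘(ℂ, E) 𝓘(ℂ, ℂ) h x' :=
      Filter.eventually_of_mem (isOpen_compl_singleton.mem_nhds hp) fun x' hx' ↦ hh x' hx'
    exact (smoothAt_fun_smul hhx (hωs x)).congr_of_eventuallyEq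
      ((cutoff_eventuallyEq f₁ hx).mono fun w hw ↦ hw.symm)

/-- **`dβ = 0` off the support of the cut-off** (there `β = h ω₁` is closed,
`mextDeriv_fun_smul_eq_zero`). [folklore] -/
theorem mextDeriv_cutoff_eq_zero (h1 : finrank ℂ E = 1)
    (hh : ∀ x, x ≠ p → MDifferentiableAt 𝓘(ℂ, E) 𝓘(ℂ, ℂ) h x) (hωs : IsSmoothForm ω₁)
    (hωc : IsClosedForm ω₁) (hωt : IsOfType 1 0 ω₁) {x : M} (hx : x ∉ tsupport f₁) :
    mextDeriv (fun x ↦ ((1 : ℂ) - f₁ x) • (h x • ω₁ x) : MForm 𝓘(ℝ, E) M ℂ 1) x = 0 := by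
  have hp : x ≠ p := ne_of_notMem_tsupport f₁ hx
  have hhx : ∀ᶠ x' in 𝓝 x, MDifferentiableAt 𝓘(ℂ, E) 𝓘(ℂ, ℂ) h x' :=
    Filter.eventually_of_mem (isOpen_compl_singleton.mem_nhds hp) fun x' hx' ↦ hh x' hx'
  rw [mextDeriv_congr_of_eventuallyEq (cutoff_eventuallyEq f₁ hx)]
  exact mextDeriv_fun_smul_eq_zero h1 hhx hωs hωc hωt

/-- **Chart formula for `dβ`.** On the target of the chart at `p`, with a `ℂ`-linear coordinate
`ℓ : E ≃ ℂ` and the cut-off read on `ℂ` as `χ = f₁ ∘ ℓ⁻¹`: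
`dβ(y)(u, w) = -(Dχ(ℓu) ℓw - Dχ(ℓw) ℓu) · A(ℓ y) · h(chart⁻¹ y)` — i.e. `dβ = -h dχ ∧ A dz`,
the term `(1 - χ) dh ∧ ω₁` vanishing on the curve. [folklore] -/
theorem inChart_mextDeriv_cutoff (h1 : finrank ℂ E = 1)
    (hh : ∀ x, x ≠ p → MDifferentiableAt 𝓘(ℂ, E) 𝓘(ℂ, ℂ) h x) (hωs : IsSmoothForm ω₁)
    (hωc : IsClosedForm ω₁) (hωt : IsOfType 1 0 ω₁) (ℓ : E ≃L[ℂ] ℂ) {y : E}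
    (hy : y ∈ (extChartAt 𝓘(ℝ, E) p).target) (u w : E) :
    (mextDeriv (fun x ↦ ((1 : ℂ) - f₁ x) • (h x • ω₁ x) : MForm 𝓘(ℝ, E) M ℂ 1)).inChart p y ![u, w] =
      -((fderiv ℝ (fun z : ℂ ↦ ((f₁.toContDiffBump (ℓ.symm z) : ℝ) : ℂ)) (ℓ y) (ℓ u) * ℓ w
          - fderiv ℝ (fun z : ℂ ↦ ((f₁.toContDiffBump (ℓ.symm z) : ℝ) : ℂ)) (ℓ y) (ℓ w) * ℓ u)
        * (ω₁.inChart p y ![ℓ.symm 1] * h ((extChartAt 𝓘(ℝ, E) p).symm y))) := by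
  set φ := extChartAt 𝓘(ℝ, E) p with hφ
  set Ω := ω₁.inChart p with hΩ
  set χ : ℂ → ℂ := fun z ↦ ((f₁.toContDiffBump (ℓ.symm z) : ℝ) : ℂ) with hχ
  set b : E → ℂ := fun y ↦ ((f₁.toContDiffBump y : ℝ) : ℂ) with hb
  set H : E → ℂ := h ∘ φ.symm with hH
  have hβs := isSmoothForm_cutoff f₁ hh hωs
  rw [inChart_mextDeriv_of_mem_target _ hy (hβs _), ModelWithCorners.Boundaryless.range_eq_univ,
    extDerivWithin_univ, inChart_cutoff]
  have hΩd : DifferentiableAt ℝ Ω y :=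
    ((hωs.contDiffOn_inChart_complex p).contDiffAt
      ((isOpen_extChartAt_target p).mem_nhds hy)).differentiableAt (by simp)
  have hbs : ContDiff ℝ ∞ b := Complex.ofRealCLM.contDiff.comp f₁.contDiff
  have hχb : ∀ y' : E, χ (ℓ y') = b y' := fun y' ↦ by simp [hχ, hb]
  have hχs : ContDiff ℝ ∞ χ := hbs.comp (ℓ.symm.contDiff.restrict_scalars ℝ)
  -- `Db(y)(v) = Dχ(ℓ y)(ℓ v)`
  have hDb : ∀ v : E, fderiv ℝ b y v = fderiv ℝ χ (ℓ y) (ℓ v) := by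
    intro v
    have hℓf : HasFDerivAt (fun y' : E ↦ ℓ y') (ℓ.toContinuousLinearMap.restrictScalars ℝ) y :=
      (ℓ.toContinuousLinearMap.restrictScalars ℝ).hasFDerivAt
    have hcomp := ((hχs.differentiable (by simp) (ℓ y)).hasFDerivAt.comp y hℓf).fderiv
    have hfun : (χ ∘ fun y' : E ↦ ℓ y') = b := funext fun y' ↦ hχb y'
    rw [hfun] at hcomp
    rw [hcomp]
    simp
  by_cases hyp : y = φ p
  · -- both sides vanish at the centre
    have hF0 : (fun y' ↦ (((1 : ℂ) - f₁ (φ.symm y')) * h (φ.symm y')) • Ω y') =ᶠ[𝓝 y]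
        fun _ ↦ 0 := by
      have hball : ∀ᶠ y' in 𝓝 y, y' ∈ φ.target ∧ dist y' (φ p) < f₁.rIn := by
        have hA : ∀ᶠ y' in 𝓝 y, y' ∈ φ.target := (isOpen_extChartAt_target p).mem_nhds hy
        have hB : ∀ᶠ y' in 𝓝 y, dist y' (φ p) < f₁.rIn := by
          rw [hyp]
          exact Metric.eventually_nhds_iff.2 ⟨f₁.rIn, f₁.rIn_pos, fun y hy ↦ hy⟩
        filter_upwards [hA, hB] with y' hy1 hy2 using ⟨hy1, hy2⟩
      filter_upwards [hball] with y' hy'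
      have hys : φ.symm y' ∈ (chartAt E p).source := by
        rw [← extChartAt_source 𝓘(ℝ, E)]; exact φ.map_target hy'.1
      have h1' : f₁ (φ.symm y') = 1 :=
        f₁.one_of_dist_le hys (by rw [φ.right_inv hy'.1]; exact hy'.2.le)
      simp [h1']
    rw [hF0.extDeriv_eq]
    have hz : extDeriv (fun _ : E ↦ (0 : E [⋀^Fin 1]→L[ℝ] ℂ)) y = 0 := by
      rw [extDeriv, fderiv_fun_const, Pi.zero_apply,
        ← ContinuousAlternatingMap.alternatizeUncurryFinCLM_apply, map_zero]
    -- the right-hand side: `Dχ(ℓ y) = 0` since `χ = 1` near `ℓ y`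
    have hχ1 : χ =ᶠ[𝓝 (ℓ y)] fun _ ↦ 1 := by
      have hb1 : (f₁.toContDiffBump : E → ℝ) =ᶠ[𝓝 y] 1 := by
        rw [hyp]; exact f₁.toContDiffBump.eventuallyEq_one
      have hc : ContinuousAt ℓ.symm (ℓ y) := ℓ.symm.continuous.continuousAt
      have hb1' : (f₁.toContDiffBump : E → ℝ) =ᶠ[𝓝 (ℓ.symm (ℓ y))] 1 := by
        rwa [ℓ.symm_apply_apply]
      filter_upwards [hc.eventually hb1'] with z hz
      simp [hχ, hz]
    have hDχ : fderiv ℝ χ (ℓ y) = 0 := by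
      rw [hχ1.fderiv_eq, fderiv_fun_const]
      rfl
    rw [hz, hDχ]
    simp
  · -- away from the centre: compute `d(F Ω)` with `F = (1 - b) H`
    have hne : y ≠ φ p := hyp
    have hV : φ.target \ {φ p} ∈ 𝓝 y :=
      ((isOpen_extChartAt_target p).sdiff isClosed_singleton).mem_nhds ⟨hy, hne⟩
    have hHd : DifferentiableAt ℂ H y :=
      (differentiableOn_comp_extChartAt_symm hh).differentiableAt hV
    have hHdr : DifferentiableAt ℝ H y := hHd.restrictScalars ℝ
    have hbd : DifferentiableAt ℝ b y := (hbs.differentiable (by simp)) y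
    have hb1d : DifferentiableAt ℝ (fun y' ↦ (1 : ℂ) - b y') y := (differentiableAt_const _).sub hbd
    set F : E → ℂ := fun y' ↦ ((1 : ℂ) - b y') * H y' with hFdef
    have hFd : DifferentiableAt ℝ F y := hb1d.mul hHdr
    have hprod : DifferentiableAt ℝ (fun y' ↦ F y' • Ω y') y := hFd.smul hΩd
    have hFeq : (fun y' ↦ (((1 : ℂ) - f₁ (φ.symm y')) * h (φ.symm y')) • Ω y') =ᶠ[𝓝 y]
        fun y' ↦ F y' • Ω y' := by
      filter_upwards [(isOpen_extChartAt_target p).mem_nhds hy] with y' hy'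
      rw [bump_apply_symm f₁ hy']
      rfl
    rw [hFeq.extDeriv_eq, extDeriv_apply_vecTwo hprod, fderiv_fun_smul hFd hΩd]
    simp only [_root_.add_apply, _root_.smul_apply, ContinuousLinearMap.smulRight_apply,
      ContinuousAlternatingMap.add_apply, ContinuousAlternatingMap.smul_apply, smul_eq_mul]
    -- the pieces
    have hDF : ∀ v : E, fderiv ℝ F y v = (1 - b y) * fderiv ℝ H y v - H y * fderiv ℝ b y v := by
      intro v
      rw [hFdef, fderiv_fun_mul hb1d hHdr, fderiv_const_sub]
      simp only [_root_.add_apply, _root_.smul_apply, smul_eq_mul, _root_.neg_apply]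
      ring
    have hdΩ : fderiv ℝ Ω y u ![w] - fderiv ℝ Ω y w ![u] = 0 := by
      rw [← extDeriv_apply_vecTwo hΩd, hΩ, extDeriv_inChart_eq_zero hωs hωc hy,
        ContinuousAlternatingMap.coe_zero, Pi.zero_apply]
    have hcomm : fderiv ℝ H y u * Ω y ![w] = fderiv ℝ H y w * Ω y ![u] :=
      apply_mul_apply_comm_of_line h1 (f := fun v ↦ fderiv ℝ H y v) (g := fun v ↦ Ω y ![v])
        (fderiv_real_apply_smul_of_differentiableAt hHd) (fun c v ↦ inChart_apply_smul hωt hy c v) u w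
    have hΩu : Ω y ![u] = Ω y ![ℓ.symm 1] * ℓ u := inChart_apply_eq_mul hωt ℓ hy u
    have hΩw : Ω y ![w] = Ω y ![ℓ.symm 1] * ℓ w := inChart_apply_eq_mul hωt ℓ hy w
    have hHy : H y = h (φ.symm y) := rfl
    rw [hDF, hDF, hDb, hDb, ← hHy]
    rw [hΩu, hΩw] at hcomm ⊢
    linear_combination (F y) * hdΩ + (1 - b y) * hcomm

end Cutoff

/-! ### The residue theorem for one pole -/

section Main

variable {E : Type*} [NormedAddCommGroup E] [NormedSpace ℂ E] [FiniteDimensional ℂ E]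
  [MeasurableSpace E] [BorelSpace E]
  {M : Type*} [TopologicalSpace M] [ChartedSpace E M]
  [IsManifold 𝓘(ℂ, E) ω M] [IsManifold 𝓘(ℝ, E) ∞ M] [T2Space M] [CompactSpace M]

omit [FiniteDimensional ℂ E] [MeasurableSpace E] [BorelSpace E] in
/-- The oriented area of the image of a real basis of the line `E` under a coordinate `ℓ : E ≃ ℂ`
is non-zero. [folklore] -/
theorem area_ne_zero (ℓ : E ≃L[ℂ] ℂ) (e : Basis (Fin 2) ℝ E) :
    (ℓ (e 0)).re * (ℓ (e 1)).im - (ℓ (e 1)).re * (ℓ (e 0)).im ≠ 0 := by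
  set b : Basis (Fin 2) ℝ ℂ := e.map (ℓ.toLinearEquiv.restrictScalars ℝ) with hb
  have hu : IsUnit (Complex.basisOneI.det b) :=
    Complex.basisOneI.is_basis_iff_det.1 ⟨b.linearIndependent, b.span_eq⟩
  have hdet : Complex.basisOneI.det b = (ℓ (e 0)).re * (ℓ (e 1)).im - (ℓ (e 1)).re * (ℓ (e 0)).im := by
    rw [Basis.det_apply, Matrix.det_fin_two]
    simp [Basis.toMatrix_apply, Complex.coe_basisOneI_repr, hb]
  rw [← hdet]
  exact hu.ne_zero

/-- **The residue theorem for one pole on a compact complex curve.** Let `M` be a compact complex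
manifold of dimension one (charts in `E`, `dim_ℂ E = 1`, with a `ℂ`-linear coordinate
`ℓ : E ≃ ℂ`), `p ∈ M`, `h : M → ℂ` complex-differentiable at every point other than `p` and
meromorphic at `p` (read in the chart at `p`), and `ω₁` a smooth closed `1`-form of type `(1,0)`.
Then the residue at `z(p)` of `(h ∘ z⁻¹) · A`, where `ω₁ = A dz` in the chart (`A(z) =
(ω₁.inChart p)(ℓ⁻¹ z)(ℓ⁻¹ 1)`), vanishes: the meromorphic `1`-form `h ω₁` has zero residue at its
only pole. Proof: Stokes for the smooth form `β = (1 - χ) h ω₁` and the `∂̄`-pairing formula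
`∫ ∂̄χ · f = -π Res f`. [cite: HormanderSCV1973, Thm. 1.2.1] -/
theorem residueAt_eq_zero_of_mdifferentiableAt (h1 : finrank ℂ E = 1) [Fact (finrank ℝ E = 2)]
    (ℓ : E ≃L[ℂ] ℂ) (p : M) {h : M → ℂ} {ω₁ : MForm 𝓘(ℝ, E) M ℂ 1}
    (hh : ∀ x, x ≠ p → MDifferentiableAt 𝓘(ℂ, E) 𝓘(ℂ, ℂ) h x) (hωs : IsSmoothForm ω₁)
    (hωc : IsClosedForm ω₁) (hωt : IsOfType 1 0 ω₁)
    (hmer : MeromorphicAt (fun z ↦ h ((extChartAt 𝓘(ℝ, E) p).symm (ℓ.symm z)))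
      (ℓ (extChartAt 𝓘(ℝ, E) p p))) :
    residueAt (fun z ↦ h ((extChartAt 𝓘(ℝ, E) p).symm (ℓ.symm z)) *
      ω₁.inChart p (ℓ.symm z) ![ℓ.symm 1]) (ℓ (extChartAt 𝓘(ℝ, E) p p)) = 0 := by
  set φ := extChartAt 𝓘(ℝ, E) p with hφ
  set T := φ.target with hT
  set zₚ : ℂ := ℓ (φ p) with hzₚ
  set Ω := ω₁.inChart p with hΩ
  set A : ℂ → ℂ := fun z ↦ Ω (ℓ.symm z) ![ℓ.symm 1] with hA
  set H : ℂ → ℂ := fun z ↦ h (φ.symm (ℓ.symm z)) with hH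
  change residueAt (fun z ↦ H z * A z) zₚ = 0
  -- orientation data
  set e := modelBasis E 2 with he
  set D := basisDetL e with hDdef
  have hD : D e = 1 := basisDetL_self e
  set o : (x : M) → Orientation ℝ (TangentSpace 𝓘(ℝ, E) x) (Fin 2) := fun _ ↦ e.orientation with ho_def
  have ho : IsContinuousOrientation o := isContinuousOrientation_const _
  set ε : ℝ := Real.sign (e.orientation.someVector e) with hε_def
  have hε : ∀ y ∈ T, chartSign o p y = ε := fun y hy ↦ chartSign_const_eq _ p hy
  have hε0 : ε ≠ 0 := sign_someVector_modelBasis_ne_zero _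
  -- nested cut-offs and the global form `β`
  obtain ⟨f₁, f₂, hr⟩ := exists_smoothBumpFunction_lt (E := E) p
  set β : MForm 𝓘(ℝ, E) M ℂ 1 := fun x ↦ ((1 : ℂ) - f₁ x) • (h x • ω₁ x) with hβdef
  have hβ : IsSmoothForm β := isSmoothForm_cutoff f₁ hh hωs
  set θ := mextDeriv β with hθdef
  have hθs : IsSmoothForm θ := isSmoothForm_mextDeriv (inChart_mextDeriv_holds _ _ _) hβ
  -- `θ = 0` where `f₂ ≠ 1`
  have hθ0 : ∀ x, f₂ x ≠ 1 → θ x = 0 := by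
    intro x hx2
    apply mextDeriv_cutoff_eq_zero f₁ h1 hh hωs hωc hωt
    intro hxt
    apply hx2
    obtain ⟨y, ⟨hyb, -⟩, rfl⟩ := f₁.tsupport_subset_symm_image_closedBall hxt
    have hyT : y ∈ T := f₁.closedBall_subset ⟨hyb, by simp⟩
    refine f₂.one_of_dist_le ?_ ?_
    · rw [← extChartAt_source 𝓘(ℝ, E)]; exact φ.map_target hyT
    · rw [φ.right_inv hyT]; exact (Metric.mem_closedBall.1 hyb).trans hr.le
  have hfθ : ∀ γ : MForm 𝓘(ℝ, E) M ℝ 2, (∀ x, θ x = 0 → γ x = 0) → (⇑f₂ • γ) = γ := by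
    intro γ hγ
    funext x
    by_cases hx2 : f₂ x = 1
    · simp [hx2]
    · rw [Pi.smul_apply', hγ x (hθ0 x hx2), smul_zero]
  have hθre : (⇑f₂ • θ.re) = θ.re := hfθ θ.re fun x hx ↦ by
    ext v; simp [MForm.re_apply, hx]
  have hθim : (⇑f₂ • θ.im) = θ.im := hfθ θ.im fun x hx ↦ by
    ext v; simp [MForm.im_apply, hx]
  -- Stokes
  have hSre : MForm.integral o θ.re = 0 := by
    have hmem : θ.re ∈ exactSmoothForms 𝓘(ℝ, E) M ℝ 2 := by
      rw [hθdef, MForm.re_mextDeriv_holds hβ]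
      exact Submodule.subset_span ⟨β.re, hβ.re, rfl⟩
    exact MForm.integral_eq_zero_of_mem_exactSmoothForms_holds (o := o) ho hmem
  have hSim : MForm.integral o θ.im = 0 := by
    have hmem : θ.im ∈ exactSmoothForms 𝓘(ℝ, E) M ℝ 2 := by
      rw [hθdef, MForm.im_mextDeriv_holds hβ]
      exact Submodule.subset_span ⟨β.im, hβ.im, rfl⟩
    exact MForm.integral_eq_zero_of_mem_exactSmoothForms_holds (o := o) ho hmem
  -- single-chart evaluation of the integral of a form supported in the chart at `p`
  have hchart : ∀ γ : MForm 𝓘(ℝ, E) M ℝ 2, IsSmoothForm γ → (⇑f₂ • γ) = γ →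
      MForm.integral o γ = 0 →
      ∃ g : E → ℝ, Continuous g ∧ HasCompactSupport g ∧
        (∀ y, g y = T.indicator (fun y ↦ γ.inChart p y e) y) ∧ ∫ y, g y ∂e.addHaar = 0 := by
    intro γ hγ hfγ hint
    obtain ⟨η, hηs, hηc, hηK, hηeq⟩ := exists_ofChart_eq_smul p f₂.contMDiff f₂.hasCompactSupport
      f₂.tsupport_subset_extChartAt_source hγ
    rw [hfγ] at hηeq
    have hηt : tsupport η ⊆ T := hηK.trans (by
      rintro _ ⟨x, hx, rfl⟩
      exact φ.map_source (f₂.tsupport_subset_extChartAt_source hx))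
    set g : E → ℝ := fun y ↦ η y e with hg
    have hgD : η = fun y ↦ g y • D := funext fun y ↦
      ContinuousAlternatingMap.eq_apply_basis_smul e (η y) D hD
    have hgcont : Continuous g := (continuous_eval_const (⇑e : Fin 2 → E)).comp hηs.continuous
    have hgsupp : tsupport g ⊆ tsupport η := by
      refine closure_mono fun y hy ↦ ?_
      rw [mem_support] at hy ⊢
      contrapose! hy
      change η y e = 0
      rw [hy, ContinuousAlternatingMap.coe_zero, Pi.zero_apply]
    have hgc : HasCompactSupport g := IsCompact.of_isClosed_subset hηc (isClosed_tsupport _) hgsupp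
    have hI : MForm.integral o γ = ε * ∫ y, g y ∂e.addHaar := by
      rw [← hηeq, hgD, MForm.integral_ofChart_smul o p hD hgcont hgc (hgsupp.trans hηt)
        (fun y hy ↦ hε y (hηt (hgsupp hy)))]
    have hg0 : ∫ y, g y ∂e.addHaar = 0 := by
      rw [hI] at hint
      exact (mul_eq_zero.1 hint).resolve_left hε0
    refine ⟨g, hgcont, hgc, fun y ↦ ?_, hg0⟩
    by_cases hyT : y ∈ T
    · rw [indicator_of_mem hyT]
      set x := φ.symm y with hx
      have hxs : x ∈ φ.source := φ.map_target hyT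
      have hyx : y = φ x := (φ.right_inv hyT).symm
      have key : (MForm.ofChart p η : MForm 𝓘(ℝ, E) M ℝ 2).inChart p (φ x) =
          (η (φ x)).compContinuousLinearMap (tangentCoordChange 𝓘(ℝ, E) p p x) :=
        MForm.inChart_ofChart_of_mem p η hxs hxs
      show η y e = γ.inChart p y e
      rw [hyx, ← hηeq, key, ContinuousAlternatingMap.compContinuousLinearMap_apply]
      congr 1
      funext i
      exact (tangentCoordChange_self hxs).symm
    · rw [indicator_of_notMem hyT]
      exact image_eq_zero_of_notMem_tsupport fun h' ↦ hyT (hηt (hgsupp h'))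
  obtain ⟨g₁, hg₁c, hg₁s, hg₁T, hg₁0⟩ := hchart θ.re hθs.re hθre hSre
  obtain ⟨g₂, hg₂c, hg₂s, hg₂T, hg₂0⟩ := hchart θ.im hθs.im hθim hSim
  -- the complex integrand on `E`
  set Gc : E → ℂ := T.indicator fun y ↦ θ.inChart p y e with hGc
  have hGc12 : ∀ y, Gc y = (g₁ y : ℂ) + I * (g₂ y : ℂ) := by
    intro y
    rw [hg₁T, hg₂T, hGc]
    by_cases hyT : y ∈ T
    · simp only [indicator_of_mem hyT]
      apply Complex.ext <;> simp [MForm.inChart_apply]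
    · simp [indicator_of_notMem hyT]
  have h1i : Integrable (fun y ↦ (g₁ y : ℂ)) e.addHaar :=
    (hg₁c.integrable_of_hasCompactSupport hg₁s).ofReal
  have h2i : Integrable (fun y ↦ I * (g₂ y : ℂ)) e.addHaar :=
    ((hg₂c.integrable_of_hasCompactSupport hg₂s).ofReal).const_mul I
  have hGc0 : ∫ y, Gc y ∂e.addHaar = 0 := by
    calc ∫ y, Gc y ∂e.addHaar = ∫ y, ((g₁ y : ℂ) + I * (g₂ y : ℂ)) ∂e.addHaar :=
          integral_congr_ae (Eventually.of_forall hGc12)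
      _ = 0 := by
          rw [integral_add h1i h2i, integral_const_mul, integral_complex_ofReal,
            integral_complex_ofReal, hg₁0, hg₂0]
          simp
  -- the cut-off read on `ℂ` and the chart formula
  set χ : ℂ → ℂ := fun z ↦ ((f₁.toContDiffBump (ℓ.symm z) : ℝ) : ℂ) with hχ
  set Δ : ℝ := (ℓ (e 0)).re * (ℓ (e 1)).im - (ℓ (e 1)).re * (ℓ (e 0)).im with hΔ
  have hΔ0 : Δ ≠ 0 := area_ne_zero ℓ e
  have hcb : Metric.closedBall (φ p) f₁.rOut ⊆ T := fun y hy ↦ f₁.closedBall_subset ⟨hy, by simp⟩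
  have hχsupp : tsupport χ ⊆ ℓ '' Metric.closedBall (φ p) f₁.rOut := by
    refine closure_minimal (fun z hz ↦ ?_) ((isCompact_closedBall _ _).image ℓ.continuous).isClosed
    rw [mem_support] at hz
    have hz' : (f₁.toContDiffBump : E → ℝ) (ℓ.symm z) ≠ 0 := fun h0 ↦ hz (by simp [hχ, h0])
    have hmem : ℓ.symm z ∈ Metric.closedBall (φ p) f₁.rOut :=
      Metric.ball_subset_closedBall (by
        rw [← f₁.toContDiffBump.support_eq]; exact mem_support.2 hz')
    exact ⟨ℓ.symm z, hmem, ℓ.apply_symm_apply z⟩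
  have hχT : tsupport χ ⊆ ℓ.symm ⁻¹' T := by
    rintro _ h'
    obtain ⟨y, hy, rfl⟩ := hχsupp h'
    show ℓ.symm (ℓ y) ∈ T
    rw [ℓ.symm_apply_apply]
    exact hcb hy
  have heq : ∀ y : E, Gc y = -(2 * I * (Δ : ℂ)) * (dbarAlong 1 χ (ℓ y) * (H (ℓ y) * A (ℓ y))) := by
    intro y
    by_cases hyT : y ∈ T
    · rw [hGc, indicator_of_mem hyT]
      have hev : (⇑e : Fin 2 → E) = ![e 0, e 1] := by
        funext i; fin_cases i <;> rfl
      rw [hev, hθdef, hβdef, inChart_mextDeriv_cutoff f₁ h1 hh hωs hωc hωt ℓ hyT (e 0) (e 1),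
        wedge_eval_eq_dbarAlong]
      simp only [hH, hA, hΩ, ℓ.symm_apply_apply, hΔ]
      ring
    · rw [hGc, indicator_of_notMem hyT]
      have hnot : ℓ y ∉ tsupport χ := fun h' ↦ hyT (by simpa using hχT h')
      rw [dbarAlong_eq_zero_of_notMem_tsupport hnot]
      simp
  -- transport to `ℂ`
  set ℓr : E ≃L[ℝ] ℂ := ⟨ℓ.toLinearEquiv.restrictScalars ℝ, ℓ.continuous, ℓ.symm.continuous⟩
    with hℓr
  obtain ⟨c, hc, hcG⟩ := exists_integral_comp_eq_mul e.addHaar ℓr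
  have hΦ0 : ∫ z, dbarAlong 1 χ z * (H z * A z) = 0 := by
    have h' : ∫ y, Gc y ∂e.addHaar =
        -(2 * I * (Δ : ℂ)) * ((c : ℂ) * ∫ z, dbarAlong 1 χ z * (H z * A z)) := by
      rw [← hcG (fun z ↦ dbarAlong 1 χ z * (H z * A z)), ← integral_const_mul]
      exact integral_congr_ae (Eventually.of_forall heq)
    rw [hGc0] at h'
    have hK : -(2 * I * (Δ : ℂ)) * (c : ℂ) ≠ 0 := by
      refine mul_ne_zero (neg_ne_zero.2 (mul_ne_zero (mul_ne_zero two_ne_zero I_ne_zero) ?_)) ?_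
      · exact_mod_cast hΔ0
      · exact_mod_cast hc.ne'
    rw [← mul_assoc] at h'
    exact (mul_eq_zero.1 h'.symm).resolve_left hK
  -- the `∂̄`-pairing formula
  set U : Set ℂ := ℓ.symm ⁻¹' T with hU
  have hUo : IsOpen U := (isOpen_extChartAt_target p).preimage ℓ.symm.continuous
  have hzU : zₚ ∈ U := by
    show ℓ.symm (ℓ (φ p)) ∈ T
    rw [ℓ.symm_apply_apply]
    exact mem_extChartAt_target p
  have hχ1 : χ =ᶠ[𝓝 zₚ] fun _ ↦ 1 := by
    have hb1 : (f₁.toContDiffBump : E → ℝ) =ᶠ[𝓝 (ℓ.symm zₚ)] 1 := by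
      rw [hzₚ, ℓ.symm_apply_apply]; exact f₁.toContDiffBump.eventuallyEq_one
    filter_upwards [ℓ.symm.continuous.continuousAt.eventually hb1] with z hz
    simp [hχ, hz]
  have hχi : ContDiff ℝ ∞ χ :=
    (Complex.ofRealCLM.contDiff.comp f₁.contDiff).comp (ℓ.symm.contDiff.restrict_scalars ℝ)
  have hχs : ContDiff ℝ 1 χ := hχi.of_le (by norm_cast)
  have hχc : HasCompactSupport χ :=
    IsCompact.of_isClosed_subset ((isCompact_closedBall _ _).image ℓ.continuous)
      (isClosed_tsupport _) hχsupp
  have hAd : DifferentiableOn ℂ A U := differentiableOn_coeff hωs hωc hωt ℓ p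
  have hHd : DifferentiableOn ℂ H (U \ {zₚ}) := by
    intro z hz
    have hyz : ℓ.symm z ∈ T \ {φ p} := by
      refine ⟨hz.1, fun h0 ↦ hz.2 ?_⟩
      rw [mem_singleton_iff] at h0 ⊢
      rw [hzₚ, ← h0, ℓ.apply_symm_apply]
    have hd := (differentiableOn_comp_extChartAt_symm (x₀ := p) hh).differentiableAt
      (((isOpen_extChartAt_target p).sdiff isClosed_singleton).mem_nhds hyz)
    exact (hd.comp z ℓ.symm.differentiableAt).differentiableWithinAt
  have hfd : DifferentiableOn ℂ (fun z ↦ H z * A z) (U \ {zₚ}) :=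
    hHd.mul (hAd.mono fun z hz ↦ hz.1)
  have hAan : AnalyticAt ℂ A zₚ := hAd.analyticAt (hUo.mem_nhds hzU)
  have hmer' : MeromorphicAt (fun z ↦ H z * A z) zₚ := hmer.mul hAan.meromorphicAt
  have key := integral_dbarAlong_mul_eq_neg_pi_mul_residueAt hUo hzU hχs hχc hχT hχ1 hfd hmer'
  rw [hΦ0] at key
  have hπ : (-(Real.pi : ℂ)) ≠ 0 := neg_ne_zero.2 (ofReal_ne_zero.2 Real.pi_ne_zero)
  exact (mul_eq_zero.1 key.symm).resolve_left hπ

end Main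

end Literature.Geometry.Kaehler

end
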